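import Mathlib
import Summits.AtomisticToContinuum.Crystallization.Theorems.SquareWellLayerCakeAveragedTwelveGhostFrame
import HarnessLib

/-!
# SquareWellLayerCake · `AveragedTwelve` — the separated far frame (stub `stub_frameSep`)

Stub `stub_frameSep` of line `Sketch` (idea `par-five-delaunay-recount`) of crux
`SquareWellLayerCake.AveragedTwelve` (item stmt-AtomisticToContinuum-15806), route
`AtomisticToContinuum/Crystallization/SquareWellLayerCake`.

SEPARATED FAR FRAME: a finite `d`-separated point set `P ⊆ ℝ³` (`d > 0`) extends to a finite
`d`-separated site set `ω ⊇ P` whose new points are all farther than any prescribed `R` from `P`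
and such that every point of `P` is interior to the convex hull of `ω`.

## Proof

This is the ghost frame of `stub_ghostFrame` (file `…AveragedTwelveGhostFrame`) with the frame
enlarged by `d`.  Put `M := ∑_{p ∈ P} ‖p‖` (so `‖p‖ ≤ M` on `P`), `L := 3M + |R| + d + 3`, let
`Γ` be the six octahedron vertices `± L • eᵢ` (`eᵢ = EuclideanSpace.single i 1`) and
`ω := P ∪ Γ`.

* far clause / mixed separation: `‖± L • eᵢ‖ = L`, so `dist g p ≥ L - M > max R d` for
  `g ∈ Γ`, `p ∈ P` (`lt_dist_of_norm_eq`);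
* frame separation: two distinct vertices `c • eᵢ ≠ c' • eⱼ` (`|c| = |c'| = L`) are at distance
  `≥ L ≥ d`, because already the `i`-th coordinate of their difference is `c` (if `i ≠ j`) or
  `c - c' = 2c` (if `i = j`, `c' = -c`);
* interior: verbatim as in the ghost frame (`ball_subset_of_convex`: `B(0, M + 1) ⊆ conv ω`,
  an open subset of the hull lies in its interior, and `P ⊆ B(0, M + 1)`).

Mathlib + the helpers of `ParFiveRecountGhostFrame`; no named facts.
-/

noncomputable section

namespace Summit.AtomisticToContinuum.Crystallization.Theorems.ParFiveRecountFrameSep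

open Metric
open Summit.AtomisticToContinuum.Crystallization.Theorems.ParFiveRecountGhostFrame

/-- Two distinct frame vertices `c • eᵢ ≠ c' • eⱼ` with `|c| = |c'| = L` are at distance at
least `L`: the `i`-th coordinates already differ by at least `L`. [folklore] -/
theorem le_dist_smul_single {c c' L : ℝ} (hc : |c| = L) (hc' : |c'| = L) {i j : Fin 3}
    (hne : c • EuclideanSpace.single i (1 : ℝ) ≠ c' • EuclideanSpace.single j (1 : ℝ)) :
    L ≤ dist (c • EuclideanSpace.single i (1 : ℝ)) (c' • EuclideanSpace.single j (1 : ℝ)) := by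
  refine le_trans ?_ (PiLp.dist_apply_le _ _ i)
  have hL0 : 0 ≤ L := hc ▸ abs_nonneg c
  by_cases hij : i = j
  · subst hij
    have hcc' : c ≠ c' := fun h => hne (by rw [h])
    have h2 : c = -c' := (abs_eq_abs.1 (hc.trans hc'.symm)).resolve_left hcc'
    simp only [PiLp.smul_apply, PiLp.single_apply, if_true, smul_eq_mul, mul_one, Real.dist_eq]
    rw [h2, show -c' - c' = -(2 * c') by ring, abs_neg, abs_mul, abs_two, hc']
    linarith
  · simp only [PiLp.smul_apply, PiLp.single_apply, if_true, if_neg hij, smul_eq_mul, mul_one,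
      mul_zero, Real.dist_eq, sub_zero]
    exact hc.ge

/-- **Separated far frame** (stub `stub_frameSep` of line `Sketch`, crux
`SquareWellLayerCake.AveragedTwelve`).  A finite `d`-separated `P ⊆ ℝ³` (`0 < d`) is contained in
a finite `d`-separated `ω` (namely `P` plus the six vertices `± L • eᵢ` of a large octahedron)
whose points outside `P` are farther than `R` from `P`, with `P` interior to `conv ω`.
[folklore] -/
theorem stub_frameSep : ∀ (P : Finset (EuclideanSpace ℝ (Fin 3))) (d R : ℝ), 0 < d → (∀ p ∈ P, ∀ q ∈ P, p ≠ q → d ≤ dist p q) → ∃ ω : Finset (EuclideanSpace ℝ (Fin 3)), P ⊆ ω ∧ (∀ a ∈ ω, ∀ b ∈ ω, a ≠ b → d ≤ dist a b) ∧ (∀ g ∈ ω, g ∉ P → ∀ p ∈ P, R < dist g p) ∧ ((↑P : Set (EuclideanSpace ℝ (Fin 3))) ⊆ interior (convexHull ℝ (↑ω : Set (EuclideanSpace ℝ (Fin 3))))) := by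
  intro P d R hd hsep
  -- a common bound on the norms of the points of `P`
  set M : ℝ := ∑ p ∈ P, ‖p‖ with hM
  have hPM : ∀ p ∈ P, ‖p‖ ≤ M := fun p hp =>
    Finset.single_le_sum (f := fun q : EuclideanSpace ℝ (Fin 3) => ‖q‖)
      (fun q _ => norm_nonneg q) hp
  have hM0 : 0 ≤ M := Finset.sum_nonneg fun p _ => norm_nonneg p
  -- the size of the frame
  set L : ℝ := 3 * M + |R| + d + 3 with hL
  have hRabs : R ≤ |R| := le_abs_self R
  have hRabs0 : 0 ≤ |R| := abs_nonneg R
  have hL0 : 0 < L := by linarith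
  have hL3 : 3 * (M + 1) ≤ L := by linarith
  have hLR : R < L - M := by linarith
  have hLd : d < L - M := by linarith
  have hdL : d ≤ L := by linarith
  -- the frame: six octahedron vertices, packaged by their properties
  obtain ⟨Γ, hplus, hminus, hnorm, hΓsep⟩ : ∃ Γ : Finset (EuclideanSpace ℝ (Fin 3)),
      (∀ i : Fin 3, L • EuclideanSpace.single i (1 : ℝ) ∈ Γ) ∧
      (∀ i : Fin 3, (-L) • EuclideanSpace.single i (1 : ℝ) ∈ Γ) ∧
      (∀ g ∈ Γ, ‖g‖ = L) ∧
      (∀ g ∈ Γ, ∀ g' ∈ Γ, g ≠ g' → L ≤ dist g g') := by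
    have habs : |L| = L := abs_of_pos hL0
    have habs' : |(-L)| = L := by rw [abs_neg, habs]
    refine ⟨(Finset.univ.image fun i : Fin 3 => L • EuclideanSpace.single i (1 : ℝ)) ∪
        (Finset.univ.image fun i : Fin 3 => (-L) • EuclideanSpace.single i (1 : ℝ)),
      fun i => ?_, fun i => ?_, fun g hg => ?_, fun g hg g' hg' hne => ?_⟩
    · exact Finset.mem_union_left _ (Finset.mem_image_of_mem _ (Finset.mem_univ i))
    · exact Finset.mem_union_right _ (Finset.mem_image_of_mem _ (Finset.mem_univ i))
    · simp only [Finset.mem_union, Finset.mem_image, Finset.mem_univ, true_and] at hg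
      rcases hg with ⟨i, rfl⟩ | ⟨i, rfl⟩
      · rw [norm_smul_single, habs]
      · rw [norm_smul_single, habs']
    · simp only [Finset.mem_union, Finset.mem_image, Finset.mem_univ, true_and] at hg hg'
      rcases hg with ⟨i, rfl⟩ | ⟨i, rfl⟩ <;> rcases hg' with ⟨j, rfl⟩ | ⟨j, rfl⟩
      · exact le_dist_smul_single habs habs hne
      · exact le_dist_smul_single habs habs' hne
      · exact le_dist_smul_single habs' habs hne
      · exact le_dist_smul_single habs' habs' hne
  refine ⟨P ∪ Γ, Finset.subset_union_left, fun a ha b hb hab => ?_,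
    fun g hg hgP p hp => ?_, fun p hp => ?_⟩
  · -- separation of `ω = P ∪ Γ`
    by_cases haP : a ∈ P <;> by_cases hbP : b ∈ P
    · exact hsep a haP b hbP hab
    · have hbΓ : b ∈ Γ := (Finset.mem_union.1 hb).resolve_left hbP
      rw [dist_comm]
      exact (lt_dist_of_norm_eq (hnorm b hbΓ) (hPM a haP) hLd).le
    · have haΓ : a ∈ Γ := (Finset.mem_union.1 ha).resolve_left haP
      exact (lt_dist_of_norm_eq (hnorm a haΓ) (hPM b hbP) hLd).le
    · have haΓ : a ∈ Γ := (Finset.mem_union.1 ha).resolve_left haP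
      have hbΓ : b ∈ Γ := (Finset.mem_union.1 hb).resolve_left hbP
      exact hdL.trans (hΓsep a haΓ b hbΓ hab)
  · -- the far clause: sites outside `P` are frame vertices
    have hgΓ : g ∈ Γ := (Finset.mem_union.1 hg).resolve_left hgP
    exact lt_dist_of_norm_eq (hnorm g hgΓ) (hPM p hp) hLR
  · -- interior: the ball `B(0, M + 1)` sits inside the hull and contains `P`
    have hPΓ : (↑Γ : Set (EuclideanSpace ℝ (Fin 3))) ⊆
        (↑(P ∪ Γ) : Set (EuclideanSpace ℝ (Fin 3))) := by
      rw [Finset.coe_union]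
      exact Set.subset_union_right
    have hball : ball (0 : EuclideanSpace ℝ (Fin 3)) (M + 1) ⊆
        convexHull ℝ (↑(P ∪ Γ) : Set (EuclideanSpace ℝ (Fin 3))) :=
      ball_subset_of_convex _ (convex_convexHull ℝ _) hL3 hL0
        (fun i => subset_convexHull ℝ _ (hPΓ (Finset.mem_coe.2 (hplus i))))
        (fun i => subset_convexHull ℝ _ (hPΓ (Finset.mem_coe.2 (hminus i))))
    refine interior_maximal hball isOpen_ball ?_
    rw [mem_ball_zero_iff]
    have := hPM p (Finset.mem_coe.1 hp)
    linarith

end Summit.AtomisticToContinuum.Crystallization.Theorems.ParFiveRecountFrameSep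

end
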